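import Mathlib.MeasureTheory.Measure.Prod
import Mathlib.Analysis.SpecialFunctions.Log.Basic
import Summits.CriticalPhenomena.CardyFormulaZ2.Theses.CardyFlipRusso
import Summits.CriticalPhenomena.CardyFormulaZ2.Theorems.CardyFlipRussoSquareFromVoronoiHubDefs
import Literature.Probability.Percolation.VoronoiCrossing
import Literature.Analysis.FunctionSpaces.PoissonPointProcess
import Literature.Analysis.FunctionSpaces.PoissonPointProcessExistence
import HarnessLib

/-!
# Vocabulary of the line `Sketch` (round 2, card `poissonised-chessboard`) for crux `SquareFromVoronoiHub`
# (stmt-CriticalPhenomena-6434, route `CardyFlipRusso`, sub-problem `CardyFormulaZ2`)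

DEFINITIONS MODULE of the line (lead `prover-line-stmt-CriticalPhenomena-6434-c4-0`, 2026-08-17): the
objects that the line skeleton `Cruxes/SquareFromVoronoiHub/Lines/Sketch.lean` (r2 k4) posits, over tree
declarations only, so that the stub files `Theorems/CardyFlipRussoSquareFromVoronoiHubChessboard*.lean`
can refer to them BY NAME, plus the KERNEL-CHECKED FACTORISATION of the crux through the line's three
statements (`squareFromVoronoiHub_of_legConstancy`, sorry-free glue).  Following the convention of the
sibling modules `…ProductLegDefs` / `…DecimationDefs`, NO closed `Prop` is defined here: the hypothesis end,
the leg constancy (the card's C⁺, the single open statement of the line) and the chessboard endpoint appear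
only as HYPOTHESES of the glue theorem.

THE LEG (card `Cruxes/SquareFromVoronoiHub/Ideas/poissonised-chessboard.md`, "put the lattice into the
colours, not the nuclei").  Fix the lattice mesh `δ > 0`, the block side `m = mOf δ = max 1 (log δ)²`
(in nucleus units) and the nucleus scale `s = sOf δ = δ / m` (so a block has side `δ` in the plane and
carries `≍ m²` nuclei).  A configuration `ω : LegConfig` consists of free black nuclei `ω.1.1.1`, free
white nuclei `ω.1.1.2`, block-type nuclei `ω.1.2` (three locally finite point configurations of `ℂ`, in
nucleus units) and block coins `ω.2 : SiteConfig ((ℤ × ℤ) ⊕ (ℤ × ℤ))` indexed by the vertices of the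
centred square lattice `G_s`; a block-type nucleus `x` is black iff the coin of its block `blk m x` is.
Along the leg `u ∈ [0, 1]` the three nucleus laws are independent Poisson processes of intensities
`(1-u)·vol`, `(1-u)·vol`, `2u·vol` (spelled out as three `IsPoissonPointProcess` hypotheses wherever used) and the coins are fair and independent, i.e. their law
is VERBATIM the crux's `sitePercolation ((ℤ × ℤ) ⊕ (ℤ × ℤ)) half` (`legMeasure`).  At `u = 0` the model
is the crux's hypothesis model `PB ⊗ PW` read at scale `s`; at `u = 1` every nucleus inherits the coin
of its block.

THE BLOCKS (this lead's choice, replacing the card's axis-parallel squares + corner coins): the block of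
a point is a cell of the cut-corner `4.8.8` partition of the plane at mesh `δ` — the `ℓ¹`-diamonds of
radius `δ/4` about the face centres `δ(ℤ² + (½,½))` (indexed by `Sum.inr`) and the complementary
cut-corner squares ("octagons") about the points of `δℤ²` (indexed by `Sum.inl`; `blkUnit`, `blk`).  Two
cells share an edge iff their indices are `Gs`-adjacent, and every vertex of the partition is trivalent,
so the black region of the `u = 1` model is, with probability `→ 1`, a fattening of the open `G_s`
clusters: the `u = 1` end is site percolation on `G_s` itself (the endpoint stubs of the skeleton), with
no geometric coin.  Every block is `C₄`-symmetric about its centre (the card's mechanism (e)).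

Sources: the card; Benjamini–Schramm, Comm. Math. Phys. 197 (1998) §1; Bollobás–Riordan, *Percolation*
(2006), Ch. 8 §§8.1–8.2 (annealed Voronoi percolation, black-increasing events); Bálint–Camia–Meester,
arXiv:0708.3349 §1.3 (divide-and-colour models; `LegConstancy` is an instance of their Conjecture 1.9,
filed as the open stub, never as a fact); Grünbaum–Shephard, *Tilings and Patterns* (1987) §2.1 (the
truncated square tiling `4.8.8`, dual to the tetrakis square tiling whose 1-skeleton is `G_s`).
-/

noncomputable section

open scoped Topology
open Filter Set MeasureTheory Metric
open Literature.Analysis.FunctionSpaces (PointConfig IsPoissonPointProcess)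
open Literature.Probability.RandomPlanarGeometry (ConformalRectangle cardyFunction crossRatio)
open Literature.Probability.Percolation (SiteConfig sitePercolation half voronoiCrossing)
open Summit.CriticalPhenomena.CardyFormulaZ2.Cruxes.SquareFromVoronoiHub.VoronoiBlocks
  (zGs Gs crudeCrossing siteCrossingProb voronoiCrossingProb squareFromVoronoiHub_iff)

namespace Summit.CriticalPhenomena.CardyFormulaZ2.Cruxes.SquareFromVoronoiHub.PoissonisedChessboard

/-! ### The cut-corner `4.8.8` block partition -/

/-- **The block of a point at unit mesh** (cut-corner `4.8.8` partition of the plane): the point `x`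
lies in the DIAMOND block `Sum.inr f` of the face `f = (⌊Re x⌋, ⌊Im x⌋)` if its `ℓ¹`-distance to the
face centre `f + (½, ½)` is at most `1/4`, and otherwise in the OCTAGON block `Sum.inl (round (Re x),
round (Im x))` of the nearest lattice point (sup-norm rounding).  Total function; the measure-zero
boundary conventions are those of `≤`, `⌊·⌋` and `round`.  The centre of the block `v` is `zGs v`.
[folklore] -/
def blkUnit (x : ℂ) : (ℤ × ℤ) ⊕ (ℤ × ℤ) :=
  if |Int.fract x.re - 1 / 2| + |Int.fract x.im - 1 / 2| ≤ 1 / 4 then Sum.inr (⌊x.re⌋, ⌊x.im⌋)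
  else Sum.inl (round x.re, round x.im)

/-- **The block of a nucleus** `x` (nucleus units) when blocks have side `m`: the unit-mesh block of
`x / m`.  In the plane (nucleus scale `s = δ/m`) the block `v` is the cell of the `4.8.8` partition at
mesh `δ` about `δ · zGs v`. [folklore] -/
def blk (m : ℝ) (x : ℂ) : (ℤ × ℤ) ⊕ (ℤ × ℤ) :=
  blkUnit (x / (m : ℂ))

/-- The centre of a block lies in that block: `blkUnit (zGs v) = v`. [folklore] -/
theorem blkUnit_zGs (v : (ℤ × ℤ) ⊕ (ℤ × ℤ)) : blkUnit (zGs v) = v := by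
  rcases v with ⟨j, k⟩ | ⟨j, k⟩
  · have hre : ((j : ℂ) + (k : ℂ) * Complex.I).re = j := by simp
    have him : ((j : ℂ) + (k : ℂ) * Complex.I).im = k := by simp
    have h : ¬ (|Int.fract (j : ℝ) - 1 / 2| + |Int.fract (k : ℝ) - 1 / 2| ≤ 1 / 4) := by
      rw [Int.fract_intCast, Int.fract_intCast]; norm_num [abs_of_neg]
    simp only [blkUnit, zGs, Sum.elim_inl, hre, him, h, if_false, round_intCast]
  · have hre : (((j : ℂ) + 1 / 2) + ((k : ℂ) + 1 / 2) * Complex.I).re = j + 1 / 2 := by simp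
    have him : (((j : ℂ) + 1 / 2) + ((k : ℂ) + 1 / 2) * Complex.I).im = k + 1 / 2 := by simp
    have hj : Int.fract ((j : ℝ) + 1 / 2) = 1 / 2 := by
      rw [Int.fract_intCast_add]; norm_num [Int.fract_eq_iff]
    have hk : Int.fract ((k : ℝ) + 1 / 2) = 1 / 2 := by
      rw [Int.fract_intCast_add]; norm_num [Int.fract_eq_iff]
    have h : |Int.fract ((j : ℝ) + 1 / 2) - 1 / 2| + |Int.fract ((k : ℝ) + 1 / 2) - 1 / 2| ≤ 1 / 4 := by
      rw [hj, hk]; norm_num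
    have hfj : ⌊(j : ℝ) + 1 / 2⌋ = j := by
      rw [Int.floor_eq_iff]; constructor <;> linarith
    have hfk : ⌊(k : ℝ) + 1 / 2⌋ = k := by
      rw [Int.floor_eq_iff]; constructor <;> linarith
    simp only [blkUnit, zGs, Sum.elim_inr, hre, him, h, if_true, hfj, hfk]

/-- A block centre at block side `m ≠ 0` lies in its own block: `blk m (m · zGs v) = v`. [folklore] -/
theorem blk_mul_zGs {m : ℝ} (hm : m ≠ 0) (v : (ℤ × ℤ) ⊕ (ℤ × ℤ)) : blk m ((m : ℂ) * zGs v) = v := by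
  unfold blk
  rw [mul_div_cancel_left₀ _ (Complex.ofReal_ne_zero.mpr hm)]
  exact blkUnit_zGs v

/-! ### Configurations, colours and the annealed law of the leg -/

/-- A configuration of the leg: `((free black nuclei, free white nuclei), block-type nuclei)` — three
locally finite point configurations of `ℂ` in nucleus units — and the block coins, a site configuration
of the centred square lattice `G_s` (the SET of blocks whose coin is black). [folklore] -/
abbrev LegConfig : Type :=
  ((PointConfig ℂ × PointConfig ℂ) × PointConfig ℂ) × SiteConfig ((ℤ × ℤ) ⊕ (ℤ × ℤ))

/-- The black nuclei of a leg configuration at block side `m`: the free black nuclei and the block-type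
nuclei lying in a block with a black coin. [folklore] -/
def blackNuclei (m : ℝ) (ω : LegConfig) : Set ℂ :=
  (ω.1.1.1 : Set ℂ) ∪ {x | x ∈ (ω.1.2 : Set ℂ) ∧ blk m x ∈ ω.2}

/-- The white nuclei of a leg configuration at block side `m`: the free white nuclei and the block-type
nuclei lying in a block with a white coin. [folklore] -/
def whiteNuclei (m : ℝ) (ω : LegConfig) : Set ℂ :=
  (ω.1.1.2 : Set ℂ) ∪ {x | x ∈ (ω.1.2 : Set ℂ) ∧ blk m x ∉ ω.2}

/-- Unfolding lemma for `blackNuclei`. [folklore] -/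
@[simp] theorem mem_blackNuclei {m : ℝ} {ω : LegConfig} {x : ℂ} :
    x ∈ blackNuclei m ω ↔ x ∈ (ω.1.1.1 : Set ℂ) ∨ (x ∈ (ω.1.2 : Set ℂ) ∧ blk m x ∈ ω.2) :=
  Iff.rfl

/-- Unfolding lemma for `whiteNuclei`. [folklore] -/
@[simp] theorem mem_whiteNuclei {m : ℝ} {ω : LegConfig} {x : ℂ} :
    x ∈ whiteNuclei m ω ↔ x ∈ (ω.1.1.2 : Set ℂ) ∨ (x ∈ (ω.1.2 : Set ℂ) ∧ blk m x ∉ ω.2) :=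
  Iff.rfl

/-- Every nucleus is black or white: the two colour classes cover the three nucleus configurations.
[folklore] -/
theorem blackNuclei_union_whiteNuclei (m : ℝ) (ω : LegConfig) :
    blackNuclei m ω ∪ whiteNuclei m ω = (ω.1.1.1 : Set ℂ) ∪ (ω.1.1.2 : Set ℂ) ∪ (ω.1.2 : Set ℂ) := by
  ext x
  simp only [mem_union, mem_blackNuclei, mem_whiteNuclei]
  tauto

/-- **The annealed law of the leg**: the three (independent) nucleus laws times fair independent block
coins — the coin factor is VERBATIM the crux's site-percolation law on `G_s`. [folklore] -/
def legMeasure (PBf PWf PK : Measure (PointConfig ℂ)) : Measure LegConfig :=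
  ((PBf.prod PWf).prod PK).prod (sitePercolation ((ℤ × ℤ) ⊕ (ℤ × ℤ)) half)

/-- The leg's crossing event of the conformal rectangle `R` at block side `m` and nucleus scale `s`:
the Literature continuum event `voronoiCrossing` (black path in `closure Ω` from `(ab)` to `(cd)`,
nuclei read at scale `s`) for the leg's colour classes. [cite: BollobasRiordan2006, Ch. 8 §8.2] -/
def legCrossing (R : ConformalRectangle) (m s : ℝ) : Set LegConfig :=
  {ω | voronoiCrossing R.carrier (R.arc 0) (R.arc 2) s (blackNuclei m ω) (whiteNuclei m ω)}

/-- The annealed crossing probability of the leg (outer measure made real, like the crux's own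
`voronoiCrossingProb`). [cite: BollobasRiordan2006, Ch. 8 §8.2] -/
def legProb (PBf PWf PK : Measure (PointConfig ℂ)) (R : ConformalRectangle) (m s : ℝ) : ℝ :=
  (legMeasure PBf PWf PK).real (legCrossing R m s)

/-! ### The schedule: block side and nucleus scale as functions of the lattice mesh -/

/-- **Block side** `m(δ) = max 1 (log δ)²` nuclei per block side at lattice mesh `δ`: any `m` with
`m² ≫ log (1/δ)` makes every disc of radius `δ/16` of a bounded window contain a nucleus with
probability `→ 1`; `(log δ)²` is a convenient overkill, `max 1` keeps it `≥ 1`. [folklore] -/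
def mOf (δ : ℝ) : ℝ := max 1 (Real.log δ ^ 2)

/-- **Nucleus scale** `s(δ) = δ / m(δ)` at lattice mesh `δ` (so that a block has side exactly `δ` in
the plane). [folklore] -/
def sOf (δ : ℝ) : ℝ := δ / mOf δ

/-- `1 ≤ m(δ)`. [folklore] -/
theorem one_le_mOf (δ : ℝ) : 1 ≤ mOf δ := le_max_left _ _

/-- `0 < m(δ)`. [folklore] -/
theorem mOf_pos (δ : ℝ) : 0 < mOf δ := one_pos.trans_le (one_le_mOf δ)

/-- `0 < s(δ)` for `δ > 0`. [folklore] -/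
theorem sOf_pos {δ : ℝ} (hδ : 0 < δ) : 0 < sOf δ := div_pos hδ (mOf_pos δ)

/-- `s(δ) ≤ δ` for `δ ≥ 0`. [folklore] -/
theorem sOf_le {δ : ℝ} (hδ : 0 ≤ δ) : sOf δ ≤ δ := div_le_self hδ (one_le_mOf δ)

/-- `s(δ) · m(δ) = δ`: a block has side `δ` in the plane. [folklore] -/
theorem sOf_mul_mOf (δ : ℝ) : sOf δ * mOf δ = δ := div_mul_cancel₀ _ (mOf_pos δ).ne'

/-- The nucleus scale is a reparametrisation of `δ → 0⁺`: `s(δ) → 0⁺`. [folklore] -/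
theorem tendsto_sOf : Tendsto sOf (𝓝[>] (0 : ℝ)) (𝓝[>] (0 : ℝ)) := by
  refine tendsto_nhdsWithin_iff.2 ⟨?_, ?_⟩
  · have h0 : Tendsto (fun δ : ℝ => δ) (𝓝[>] (0 : ℝ)) (𝓝 0) :=
      tendsto_nhdsWithin_of_tendsto_nhds tendsto_id
    refine squeeze_zero' ?_ ?_ h0
    · filter_upwards [self_mem_nhdsWithin] with δ hδ using (sOf_pos hδ).le
    · filter_upwards [self_mem_nhdsWithin] with δ hδ using sOf_le (le_of_lt hδ)
  · filter_upwards [self_mem_nhdsWithin] with δ hδ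
    exact sOf_pos hδ

/-! ### The crux factors through the leg (kernel-checked glue) -/

/-- **The crux factors through the poissonised-chessboard leg** (the card's `TransferClaim`, proved):
if (H) under the crux's hypothesis the `u = 0` leg probabilities tend to Cardy's `F(η)` for every
conformal rectangle (`hH`, the HYPOTHESIS END — provable: at `u = 0` the block-type nuclei are a.s.
absent and `δ ↦ s(δ)` reparametrises `δ → 0⁺`), (K) the leg probabilities are asymptotically constant in
`u`, uniformly on `[0,1]` (`hK`, LEG CONSTANCY — the card's C⁺, the single OPEN statement of the line,
an instance of the divide-and-colour universality conjecture), and (E) Cardy for the `u = 1` leg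
probabilities of every conformal rectangle implies Cardy for the crude site crossing of `G_s` (`hE`,
the CHESSBOARD ENDPOINT — provable: with the `4.8.8` blocks the `u = 1` black region is a fattening of
the open `G_s` clusters with probability `→ 1`), then the crux `CardyFlipRusso.SquareFromVoronoiHub`
holds.  Proof: the Poisson laws of the two ends exist (`existsUnique_isPoissonPointProcess_holds`); an
`ε/2` argument. [folklore] -/
theorem squareFromVoronoiHub_of_legConstancy
    (hH : (∀ (PB PW : Measure (PointConfig ℂ)),
        IsPoissonPointProcess (volume : Measure ℂ) PB → IsPoissonPointProcess (volume : Measure ℂ) PW →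
        ∀ R : ConformalRectangle, R.HasCrossingLimit (voronoiCrossingProb PB PW R) cardyFunction) →
      ∀ (PBf PWf PK : Measure (PointConfig ℂ)),
        IsPoissonPointProcess (volume : Measure ℂ) PBf → IsPoissonPointProcess (volume : Measure ℂ) PWf →
        IsPoissonPointProcess (0 : Measure ℂ) PK →
        ∀ R : ConformalRectangle,
          R.HasCrossingLimit (fun δ => legProb PBf PWf PK R (mOf δ) (sOf δ)) cardyFunction)
    (hK : ∀ R : ConformalRectangle, ∀ ε > (0 : ℝ), ∀ᶠ δ in 𝓝[>] (0 : ℝ),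
      ∀ u ∈ Icc (0 : ℝ) 1, ∀ u' ∈ Icc (0 : ℝ) 1,
        ∀ PBf PWf PK PBf' PWf' PK' : Measure (PointConfig ℂ),
          IsPoissonPointProcess (ENNReal.ofReal (1 - u) • (volume : Measure ℂ)) PBf →
          IsPoissonPointProcess (ENNReal.ofReal (1 - u) • (volume : Measure ℂ)) PWf →
          IsPoissonPointProcess (ENNReal.ofReal (2 * u) • (volume : Measure ℂ)) PK →
          IsPoissonPointProcess (ENNReal.ofReal (1 - u') • (volume : Measure ℂ)) PBf' →
          IsPoissonPointProcess (ENNReal.ofReal (1 - u') • (volume : Measure ℂ)) PWf' →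
          IsPoissonPointProcess (ENNReal.ofReal (2 * u') • (volume : Measure ℂ)) PK' →
            |legProb PBf PWf PK R (mOf δ) (sOf δ) - legProb PBf' PWf' PK' R (mOf δ) (sOf δ)| ≤ ε)
    (hE : (∀ (PBf PWf PK : Measure (PointConfig ℂ)),
        IsPoissonPointProcess (0 : Measure ℂ) PBf → IsPoissonPointProcess (0 : Measure ℂ) PWf →
        IsPoissonPointProcess ((2 : ENNReal) • (volume : Measure ℂ)) PK →
        ∀ R : ConformalRectangle,
          R.HasCrossingLimit (fun δ => legProb PBf PWf PK R (mOf δ) (sOf δ)) cardyFunction) →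
      ∀ R : ConformalRectangle, R.HasCrossingLimit (siteCrossingProb R) cardyFunction) :
    Summit.CriticalPhenomena.CardyFormulaZ2.Theses.CardyFlipRusso.SquareFromVoronoiHub := by
  refine squareFromVoronoiHub_iff.mpr fun hV => hE ?_
  intro PBf PWf PK hBf hWf hK1 R φ x hux
  -- the `u = 0` laws exist
  obtain ⟨P, hP, -⟩ :=
    Literature.Analysis.FunctionSpaces.existsUnique_isPoissonPointProcess_holds (E := ℂ)
      (volume : Measure ℂ) (fun z => measure_singleton z)
  obtain ⟨P₀, hP₀, -⟩ :=
    Literature.Analysis.FunctionSpaces.existsUnique_isPoissonPointProcess_holds (E := ℂ)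
      (0 : Measure ℂ) (fun z => by simp)
  have hlim₀ : Tendsto (fun δ => legProb P P P₀ R (mOf δ) (sOf δ)) (𝓝[>] 0)
      (𝓝 (cardyFunction (crossRatio x))) := hH hV P P P₀ hP hP hP₀ R φ x hux
  -- the laws in the form consumed by the constancy hypothesis
  have hP' : IsPoissonPointProcess (ENNReal.ofReal (1 - 0) • (volume : Measure ℂ)) P := by simpa using hP
  have hP₀' : IsPoissonPointProcess (ENNReal.ofReal (2 * 0) • (volume : Measure ℂ)) P₀ := by simpa using hP₀
  have hBf' : IsPoissonPointProcess (ENNReal.ofReal (1 - 1) • (volume : Measure ℂ)) PBf := by simpa using hBf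
  have hWf' : IsPoissonPointProcess (ENNReal.ofReal (1 - 1) • (volume : Measure ℂ)) PWf := by simpa using hWf
  have hK1' : IsPoissonPointProcess (ENNReal.ofReal (2 * 1) • (volume : Measure ℂ)) PK := by simpa using hK1
  -- constancy along the leg
  have hdiff : Tendsto (fun δ => legProb PBf PWf PK R (mOf δ) (sOf δ) - legProb P P P₀ R (mOf δ) (sOf δ))
      (𝓝[>] 0) (𝓝 0) := by
    rw [Metric.tendsto_nhds]
    intro ε hε
    filter_upwards [hK R (ε / 2) (half_pos hε)] with δ hδ
    have h := hδ 1 ⟨zero_le_one, le_rfl⟩ 0 ⟨le_rfl, zero_le_one⟩ PBf PWf PK P P P₀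
      hBf' hWf' hK1' hP' hP' hP₀'
    rw [Real.dist_0_eq_abs]
    linarith
  have h := hdiff.add hlim₀
  simp only [sub_add_cancel, zero_add] at h
  exact h

/-- **Registered glue `stub_chessboardGlue`**: the crux factors through the three statements of the
line (hypothesis end, leg constancy, chessboard endpoint) — the statement of
`squareFromVoronoiHub_of_legConstancy`. [folklore] -/
theorem stub_chessboardGlue : ((∀ (PB PW : Measure (PointConfig ℂ)),
      IsPoissonPointProcess (volume : Measure ℂ) PB → IsPoissonPointProcess (volume : Measure ℂ) PW →
      ∀ R : ConformalRectangle, R.HasCrossingLimit (voronoiCrossingProb PB PW R) cardyFunction) →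
    ∀ (PBf PWf PK : Measure (PointConfig ℂ)),
      IsPoissonPointProcess (volume : Measure ℂ) PBf → IsPoissonPointProcess (volume : Measure ℂ) PWf →
      IsPoissonPointProcess (0 : Measure ℂ) PK →
      ∀ R : ConformalRectangle,
        R.HasCrossingLimit (fun δ => legProb PBf PWf PK R (mOf δ) (sOf δ)) cardyFunction) →
    (∀ R : ConformalRectangle, ∀ ε > (0 : ℝ), ∀ᶠ δ in 𝓝[>] (0 : ℝ),
    ∀ u ∈ Icc (0 : ℝ) 1, ∀ u' ∈ Icc (0 : ℝ) 1,
      ∀ PBf PWf PK PBf' PWf' PK' : Measure (PointConfig ℂ),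
        IsPoissonPointProcess (ENNReal.ofReal (1 - u) • (volume : Measure ℂ)) PBf →
        IsPoissonPointProcess (ENNReal.ofReal (1 - u) • (volume : Measure ℂ)) PWf →
        IsPoissonPointProcess (ENNReal.ofReal (2 * u) • (volume : Measure ℂ)) PK →
        IsPoissonPointProcess (ENNReal.ofReal (1 - u') • (volume : Measure ℂ)) PBf' →
        IsPoissonPointProcess (ENNReal.ofReal (1 - u') • (volume : Measure ℂ)) PWf' →
        IsPoissonPointProcess (ENNReal.ofReal (2 * u') • (volume : Measure ℂ)) PK' →
          |legProb PBf PWf PK R (mOf δ) (sOf δ) - legProb PBf' PWf' PK' R (mOf δ) (sOf δ)| ≤ ε) →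
    ((∀ (PBf PWf PK : Measure (PointConfig ℂ)),
      IsPoissonPointProcess (0 : Measure ℂ) PBf → IsPoissonPointProcess (0 : Measure ℂ) PWf →
      IsPoissonPointProcess ((2 : ENNReal) • (volume : Measure ℂ)) PK →
      ∀ R : ConformalRectangle,
        R.HasCrossingLimit (fun δ => legProb PBf PWf PK R (mOf δ) (sOf δ)) cardyFunction) →
    ∀ R : ConformalRectangle, R.HasCrossingLimit (siteCrossingProb R) cardyFunction) →
    Summit.CriticalPhenomena.CardyFormulaZ2.Theses.CardyFlipRusso.SquareFromVoronoiHub :=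
  fun hH hK hE => squareFromVoronoiHub_of_legConstancy hH hK hE

end Summit.CriticalPhenomena.CardyFormulaZ2.Cruxes.SquareFromVoronoiHub.PoissonisedChessboard

end
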